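import Summits.AtomisticToContinuum.HydrodynamicLimit.Theses.RelayRaceLocality

/-!
# Crux idea `linear-response-light-cone` — first lemma (crux-ideate r2 k4, stmt-AtomisticToContinuum-12500)

`LinearResponseLightCone`: the FLUCTUATION-LEVEL shadow of `LightConeInLaw` at pure equilibrium — the classical
Lieb–Robinson object. Under the homogeneous (invariant) Gibbs law `G`, the covariance between the exterior CURRENT
statistic `S = Σ_i ψ(x_i(0))·v_i(0)` (`ψ` a continuous vector weight vanishing on the ball `B(x₀,R)`; `S` has mean
`0` and standard deviation `≍ √N`) and any bounded Lipschitz functional of the reduced interior fields at time `t`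
(support in `B(x₀, R − c t)`; fluctuations `≍ N^{-1/2}`) tends to `0`: normalised equilibrium fluctuation fields at
Euler scale do not correlate across the cone (Landau–Placzek support of the dynamic structure factor). It is the
`λ`-derivative at `λ = 0` of the crux's island case along the exterior tilt `e^{λS}` and vanishes identically at
`t = 0` (disjoint particle sets, velocities independent of positions under `G`). Typed, unproved; not an item.
-/

namespace Summit.AtomisticToContinuum.HydrodynamicLimit.Cruxes.LightConeInLaw.VirginFront

open MeasureTheory Filter Set Topology
open scoped RealInnerProductSpace
open Literature.MathematicalPhysics.KineticTheory Literature.Analysis.FluidPDE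

noncomputable section

/-- **Linear-response light cone (equilibrium, second moment).** See the module docstring. -/
def LinearResponseLightCone : Prop :=
  ∀ a θ : ℝ, 0 < a → 0 < θ → ∃ σ₀ : ℝ, 0 < σ₀ ∧ ∃ c : ℝ, 0 < c ∧ ∀ σ : ℝ, 0 < σ → σ < σ₀ →
  ∀ Φ : (N : ℕ) → HardSphereFlow (Torus.geometry (Fin 3)) (hsDiameter σ N) (N + 1),
  ∀ t : ℝ, 0 ≤ t → ∀ (x₀ : T3) (R : ℝ),
  ∀ ψ : T3 → V3, Continuous ψ → (∀ x, Torus.euclidDist x x₀ < R → ψ x = 0) →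
  ∀ χ : T3 → ℝ, Continuous χ → (∀ x, R - c * t ≤ Torus.euclidDist x x₀ → χ x = 0) →
  ∀ F : ℝ × V3 × ℝ → ℝ, LipschitzWith 1 F → (∀ p, |F p| ≤ 1) →
  let G : (N : ℕ) → Measure (Config (N + 1) (Fin 3) T3) :=
    fun N => localGibbsLaw σ (fun _ => a) (fun _ => 0) (fun _ => θ) N (Φ N)
  let S : (N : ℕ) → Config (N + 1) (Fin 3) T3 → ℝ := fun _ z => ∑ i, ⟪ψ (z i).1, (z i).2⟫
  let Y : (N : ℕ) → Config (N + 1) (Fin 3) T3 → ℝ := fun N z =>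
    F (σ ^ 3 * empiricalDensityField ((Φ N).flow t z) χ,
      (σ ^ 3) • empiricalMomentumField ((Φ N).flow t z) χ,
      σ ^ 3 * empiricalEnergyField ((Φ N).flow t z) χ)
  Tendsto (fun N => (∫ z, S N z * Y N z ∂(G N)) - (∫ z, S N z ∂(G N)) * (∫ z, Y N z ∂(G N)))
    atTop (𝓝 0)

end

end Summit.AtomisticToContinuum.HydrodynamicLimit.Cruxes.LightConeInLaw.VirginFront
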